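import Literature.AlgebraicGeometry.Motives.HodgeThetaSubalgebraUnitaryCoprimeCore
import Literature.LinearAlgebra.DiagonalizableSpectralResolution
import HarnessLib

/-!
# The `Θ`-subalgebra theorem in rank ten, complex–Hermitian core: `𝔤_ℂ = 𝔰𝔭₁₀` unless `𝔤_ℂ` is in the
# plus-line (Mumford-type) position (Moonen–Zarhin 1999 §2, `g = 5`: «`Hg(X) = Sp_D(V,φ)`»; Tankeev, Ribet)

Family `hodge`, layer `Literature/AlgebraicGeometry/Motives` (abstract polarizable `ℚ`-Hodge structures; no
geometry). Research context: cell `pub-hodge-ring2` (HONEST FRAMING: research route conditional on HC_CM; not a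
corollary; Q11.4-sentence-2 already refuted in dim ≥ 3), Literature lane (lit gen 67), programme R44 = heir item
H4a of the lane: shape (S1) of `Summit.HodgeConjecture.Ring2.FivefoldFactTwoShapes` — the LAST clause of the
fivefold fact `MoonenZarhin1999_codimTwoHodgeClasses_abelianFivefold` (simple complex abelian fivefolds with
`End⁰ = ℚ`). UNCONDITIONAL Hodge–Lie linear algebra; theorems only, no definition, no named fact (D-0026), no `sorry`.

THE PRINTED THEOREM. B. Moonen, Yu. Zarhin, *Hodge classes on abelian varieties of low dimension*, Math. Ann.
315 (1999) 711–733 [held `paper:arxiv-math_9901113`], §2 p. 715: «For `g := dim(X) ≤ 3` and `g = 5` we always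
find that `Hg(X) = Sp_D(V,φ)`. […] it follows that `B(Xⁿ) = D(Xⁿ)` for all `n`.»; (2.4)–(2.7) (Tankeev, Ribet:
simple abelian varieties of prime dimension). For `End⁰(X) = ℚ`, `g = 5`, this is Ribet 1983 Thm. 1 with
`E = ℚ` (relative dimension `5`, odd).

WHY A NEW CORE. The tree's rank-six programme (`HodgeThetaSubalgebraSymplecticRankSix{,Reduction,Dichotomy,
Skeleton,Killing,TraceForm,Hodge}`) reaches «`𝔊 = 𝔰𝔭₆` or the E³-type skeleton» by a purely complex analysis
in `dim V^{1,0} = 3` (spectral lemma, Cartan/Engel). In `dim V^{1,0} = 5` we use instead the REAL STRUCTURE of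
`𝔤_ℂ = 𝔤 ⊗ ℂ` (Deligne, LNM 900, I §3: complex conjugation exchanges `V^{1,0}` and `V^{0,1}` and preserves `𝔤_ℂ`):
for a raising operator `B ∈ 𝔤_ℂ` (`B(V^{1,0}) = 0`, `B(V_ℂ) ⊆ V^{1,0}`) its conjugate `B̄ = conj ∘ B ∘ conj` is
a lowering operator in `𝔤_ℂ`, and the Levi element `B B̄|_{V^{1,0}}` is SELF-ADJOINT for the definite Hermitian
form `ψ_ℂ(x, conj y)` of the polarization (second Hodge–Riemann relation), hence diagonalizable with real
spectrum; all polynomials in it lie in the Levi line algebra `𝔩` (the `(2,3)`-file's `UnitaryThetaCore.aeval_sub_aeval_mem`),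
so its spectral projectors do (Hoffman–Kunze §6.7: `E_j = p_j(T)`). In dimension `5` a diagonalizable operator
has an eigenvalue of multiplicity `1` (a rank-one idempotent in `𝔩` — the rank-six criterion
`SymplecticThetaSix.eq_top_of_rankOne_idempotent`), or two eigenvalues of multiplicities `{2,3}` (an involution in
`𝔩` with eigenspaces of dimensions `2|3` — the `(2,3)` core `UnitaryThetaCore.eq_top_two_three'` of lit gen 66),
or is a scalar. Hence:

* §1 `SymplecticThetaTen.conjOp_raise`, `conjOp_skew`, `form_mul_conjOp_conj` — the conjugate of a raising
  operator is lowering and `ψ_ℂ`-skew; `ψ_ℂ(B B̄ p, conj p′) = ψ_ℂ(p, conj (B B̄ p′)) = −ψ_ℂ(B̄ p, conj (B̄ p′))`.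
* §2 `SymplecticThetaTen.iSup_eigenspace_eq_top_of_selfAdjoint` — pure linear algebra: an operator self-adjoint
  for a definite sesquilinear pairing is diagonalizable (its generalized eigenspaces are eigenspaces).
* §3 `SymplecticThetaTen.aeval_mem_levi` — `p(B B̄|_{V^{1,0}}) ∈ 𝔩` for every polynomial `p`;
  **`SymplecticThetaTen.levi_eq_top_or_scalar`** — for `dim V = 10`: either the Levi line algebra is
  `End(V^{1,0})` or `B B̄|_{V^{1,0}}` is a scalar.
* §4 **`SymplecticThetaTen.mem_spanC_of_skew_of_levi`** (any rank) — if the Levi line algebra is everything then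
  `𝔤_ℂ ∋` every `ψ_ℂ`-skew operator (a rank-one idempotent realised in `𝔤_ℂ`, then `SymplecticThetaSix.core_of_rankOne`);
  **`SymplecticThetaTen.plusLine_of_forall_scalar`** (any rank) — if every `B B̄|_{V^{1,0}}` is a scalar then
  `𝔤_ℂ⁺ = ℂB₀`, `𝔤_ℂ⁻ = ℂB̄₀` with `B₀B̄₀ = μ₀` on `V^{1,0}`, `B̄₀B₀ = μ₀` on `V^{0,1}`, `μ₀` real non-zero
  (polarization of the scalar identity in `t ↦ B₀ + tB`; the PLUS-LINE position of the tree's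
  `HodgeLieWeightOnePlusLine*`, i.e. the Mumford-type mechanism `𝔰𝔩₂ ⊗ 1 ⊕ 1 ⊗ 𝔨` on `ℂ² ⊗ W`);
  **`SymplecticThetaTen.dichotomy`** — for `dim V = 10`, `End_Hdg(V) = ℚ`: `𝔤_ℂ = 𝔰𝔭(V,ψ)_ℂ` OR the plus-line
  position. (The arithmetic exclusion of the plus line under `End_Hdg = ℚ`, `dim V = 10` — Moonen–Zarhin's
  «`g = 5`: `Hg = Sp`» — is the sequel.)

## References

* [MoonenZarhin1999LowDim] B. Moonen, Yu. Zarhin, Math. Ann. 315 (1999), §2 p. 715, (2.3)–(2.7)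
  [corpus: paper:arxiv-math_9901113 p0005].
* [Ribet1983] K. A. Ribet, *Hodge classes on certain types of abelian varieties*, Amer. J. Math. 105 (1983), Thm. 1.
* [Deligne1982HodgeCycles] P. Deligne, *Hodge cycles on abelian varieties*, LNM 900 (1982), I §3 (proof of Prop. 3.4,
  Prop. 3.6: real structure, `ad C` a Cartan involution).
* [Mumford1969NoteShimura] D. Mumford, *A note of Shimura's paper …*, Math. Ann. 181 (1969), §4 (the rank-eight
  examples with `Hg ≠ Sp`: the plus-line position is not empty over `ℝ`).
* [HoffmanKunze1971LinearAlgebra] K. Hoffman, R. Kunze, *Linear Algebra* (1971), §6.7 Thm. 11, §8.5 (self-adjoint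
  operators are diagonalizable), §9.5 (spectral resolution).
* [GoodmanWallachGTM255] R. Goodman, N. R. Wallach, GTM 255 (2009), §2.1.2 (`𝔰𝔭` in block form), §4.1.1.
* [Gordon1997] B. B. Gordon, *A survey of the Hodge conjecture for abelian varieties*, §6 (proof of Thm. 6.3.3).
-/

noncomputable section

open scoped TensorProduct
open Polynomial

namespace Literature.AlgebraicGeometry.Motives

namespace HodgeStructure

universe u

/-! ### §1 The conjugate of a raising operator -/

section ConjOp

variable {V : Type u} [AddCommGroup V] [Module ℚ V] {n : ℤ}

/-- **The conjugate `B̄ = conj ∘ B ∘ conj` of an operator raising `Q` into `P` lowers `P` into `Q`** when `conj`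
exchanges `P` and `Q` (weight one: `conj V^{1,0} = V^{0,1}`): `B̄(Q) = 0`, `B̄(V_ℂ) ⊆ Q`, and
`conj (B̄ v) = B (conj v)`, `conj (B v) = B̄ (conj v)`. [cite: Deligne1982HodgeCycles, I §3 (proof of Prop. 3.4)]
[cite: GoodmanWallachGTM255, §2.1.2] -/
theorem SymplecticThetaTen.conjOp_raise {P Q : Submodule ℂ (ℂ ⊗[ℚ] V)} (hPQ : ∀ x ∈ P, conj x ∈ Q)
    (hQP : ∀ x ∈ Q, conj x ∈ P) {B C : Module.End ℂ (ℂ ⊗[ℚ] V)} (hBP : ∀ p ∈ P, B p = 0)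
    (hBim : ∀ v, B v ∈ P) (hC : ∀ v, C v = conj (B (conj v))) :
    (∀ q ∈ Q, C q = 0) ∧ (∀ v, C v ∈ Q) ∧ (∀ v, conj (C v) = B (conj v)) ∧ (∀ v, conj (B v) = C (conj v)) := by
  refine ⟨fun q hq => ?_, fun v => ?_, fun v => ?_, fun v => ?_⟩
  · rw [hC, hBP _ (hQP q hq), map_zero]
  · rw [hC]; exact hPQ _ (hBim _)
  · rw [hC, conj_conj]
  · rw [hC, conj_conj]

/-- **The conjugate of a `ψ_ℂ`-skew operator is `ψ_ℂ`-skew** (`ψ_ℂ(conj x, conj y) = conj ψ_ℂ(x, y)`: the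
polarization is defined over `ℚ`). [cite: Deligne1982HodgeCycles, I §3 (proof of Prop. 3.4)] -/
theorem SymplecticThetaTen.conjOp_skew (Q : LinearMap.BilinForm ℚ V) {B C : Module.End ℂ (ℂ ⊗[ℚ] V)}
    (hC : ∀ v, C v = conj (B (conj v)))
    (hB : ∀ x y, Q.baseChange ℂ (B x) y + Q.baseChange ℂ x (B y) = 0) (x y : ℂ ⊗[ℚ] V) :
    Q.baseChange ℂ (C x) y + Q.baseChange ℂ x (C y) = 0 := by
  have h1 : Q.baseChange ℂ (C x) y = starRingEnd ℂ (Q.baseChange ℂ (B (conj x)) (conj y)) := by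
    rw [hC, ← form_baseChange_conj, conj_conj]
  have h2 : Q.baseChange ℂ x (C y) = starRingEnd ℂ (Q.baseChange ℂ (conj x) (B (conj y))) := by
    rw [hC, ← form_baseChange_conj, conj_conj]
  rw [h1, h2, ← map_add, hB, map_zero]

/-- **`B B̄|_P` is self-adjoint for the pairing `ψ_ℂ(x, conj y)` and `ψ_ℂ(B B̄ p, conj p) = −ψ_ℂ(B̄ p, conj (B̄ p))`**
(`B` raising and `ψ_ℂ`-skew, `B̄` its conjugate). [cite: Deligne1982HodgeCycles, I §3 (proof of Prop. 3.4, Prop. 3.6)]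
[cite: HoffmanKunze1971LinearAlgebra, §8.5] -/
theorem SymplecticThetaTen.form_mul_conjOp_conj (Q : LinearMap.BilinForm ℚ V) {B C : Module.End ℂ (ℂ ⊗[ℚ] V)}
    (hC : ∀ v, C v = conj (B (conj v)))
    (hB : ∀ x y, Q.baseChange ℂ (B x) y + Q.baseChange ℂ x (B y) = 0) (p p' : ℂ ⊗[ℚ] V) :
    Q.baseChange ℂ (B (C p)) (conj p') = Q.baseChange ℂ p (conj (B (C p'))) ∧
      Q.baseChange ℂ (B (C p)) (conj p) = -Q.baseChange ℂ (C p) (conj (C p)) := by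
  have hCskew := SymplecticThetaTen.conjOp_skew Q hC hB
  have hcC : ∀ v, conj (C v) = B (conj v) := fun v => by rw [hC, conj_conj]
  have hcB : ∀ v, conj (B v) = C (conj v) := fun v => by rw [hC, conj_conj]
  have key : ∀ p₁ p₂ : ℂ ⊗[ℚ] V, Q.baseChange ℂ (B (C p₁)) (conj p₂) = -Q.baseChange ℂ (C p₁) (conj (C p₂)) :=
    fun p₁ p₂ => by
      have h := hB (C p₁) (conj p₂)
      rw [hcC p₂]
      linear_combination h
  refine ⟨?_, key p p⟩
  rw [key, hcB]
  have h := hCskew p (conj (C p'))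
  linear_combination -h

end ConjOp

/-! ### §2 An operator self-adjoint for a definite sesquilinear pairing is diagonalizable -/

section SelfAdjoint

variable {W : Type*} [AddCommGroup W] [Module ℂ W]

/-- **Self-adjoint operators for a definite sesquilinear pairing are diagonalizable.** Let `s : W → W → ℂ` be
additive in each variable, `ℂ`-linear in the first, conjugate-linear in the second, with `s(x, x) = 0 ⟹ x = 0`,
and let `A` satisfy `s(A x, y) = s(x, A y)`. Then every eigenvalue of `A` is real, `ker (A − μ)² = ker (A − μ)`,
and the eigenspaces of `A` span `W` (over `ℂ` the generalized eigenspaces always do). Hoffman–Kunze §8.5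
Thm. 18 / §9.5 for a Hermitian inner product; only definiteness is used. [cite: HoffmanKunze1971LinearAlgebra, §8.5 and §9.5] -/
theorem SymplecticThetaTen.iSup_eigenspace_eq_top_of_selfAdjoint [FiniteDimensional ℂ W] (s : W → W → ℂ)
    (hadd₁ : ∀ x y z, s (x + y) z = s x z + s y z) (hsmul₁ : ∀ (c : ℂ) x z, s (c • x) z = c * s x z)
    (hadd₂ : ∀ x y z, s x (y + z) = s x y + s x z)
    (hsmul₂ : ∀ (c : ℂ) x y, s x (c • y) = starRingEnd ℂ c * s x y) (hdef : ∀ x, s x x = 0 → x = 0)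
    (A : Module.End ℂ W) (hA : ∀ x y, s (A x) y = s x (A y)) :
    (∀ μ : ℂ, A.HasEigenvalue μ → starRingEnd ℂ μ = μ) ∧
      (∀ (μ : ℂ) (x : W), (A - μ • 1) ((A - μ • 1) x) = 0 → (A - μ • 1) x = 0) ∧
      ⨆ μ : ℂ, A.eigenspace μ = ⊤ := by
  have hs0 : ∀ x, s x 0 = 0 := fun x => by
    have h := hadd₂ x 0 0
    rw [add_zero] at h
    linear_combination -h
  -- eigenvalues are real
  have hreal : ∀ μ : ℂ, A.HasEigenvalue μ → starRingEnd ℂ μ = μ := by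
    intro μ hμ
    obtain ⟨v, hv⟩ := hμ.exists_hasEigenvector
    have hv0 : s v v ≠ 0 := fun h => hv.2 (hdef v h)
    have h1 : s (A v) v = μ * s v v := by rw [hv.apply_eq_smul, hsmul₁]
    have h2 : s (A v) v = starRingEnd ℂ μ * s v v := by rw [hA, hv.apply_eq_smul, hsmul₂]
    exact mul_right_cancel₀ hv0 (h2.symm.trans h1)
  -- `ker (A - μ)² = ker (A - μ)`
  have hsq : ∀ (μ : ℂ) (x : W), (A - μ • 1) ((A - μ • 1) x) = 0 → (A - μ • 1) x = 0 := by
    intro μ x hx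
    by_cases hμ : A.HasEigenvalue μ
    · have hμr := hreal μ hμ
      set y := (A - μ • 1) x with hy
      -- `s((A - μ) a, b) = s(a, (A - μ) b)` for real `μ`
      have hAμ : ∀ a b, s ((A - μ • 1) a) b = s a ((A - μ • 1) b) := fun a b => by
        simp only [LinearMap.sub_apply, LinearMap.smul_apply, Module.End.one_apply]
        rw [sub_eq_add_neg, sub_eq_add_neg, hadd₁, hadd₂, ← neg_one_smul ℂ (μ • a), ← neg_one_smul ℂ (μ • b),
          hsmul₁, hsmul₁, hsmul₂, hsmul₂, hμr, hA, map_neg, map_one]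
      apply hdef
      rw [hy, hAμ, ← hy, hx, hs0]
    · -- `μ` is not an eigenvalue: `A - μ` is injective
      have hker : LinearMap.ker (A - μ • 1) = ⊥ := by
        rw [Module.End.hasEigenvalue_iff, Module.End.eigenspace_def, not_not.symm.not, not_not] at hμ
        simpa [Module.End.eigenspace_def] using hμ
      have : (A - μ • 1) x ∈ LinearMap.ker (A - μ • 1) := LinearMap.mem_ker.2 hx
      rw [hker, Submodule.mem_bot] at this
      exact this
  refine ⟨hreal, hsq, ?_⟩
  -- generalized eigenspaces are eigenspaces
  have hpow : ∀ (μ : ℂ) (k : ℕ) (x : W), ((A - μ • 1) ^ (k + 1)) x = 0 → (A - μ • 1) x = 0 := by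
    intro μ k
    induction k with
    | zero => intro x hx; simpa using hx
    | succ k ih =>
      intro x hx
      apply ih
      rw [pow_succ, Module.End.mul_apply] at hx ⊢
      rw [pow_succ, Module.End.mul_apply] at hx
      -- `(A-μ)^k ((A-μ)((A-μ) x)) = 0` ⟹ by `ih` applied to `(A - μ) x`... reorganise via commuting powers
      have hcomm : ∀ (j : ℕ) (w : W), ((A - μ • 1) ^ j) ((A - μ • 1) w) = (A - μ • 1) (((A - μ • 1) ^ j) w) :=
        fun j w => by rw [← Module.End.mul_apply, ← pow_succ, pow_succ', Module.End.mul_apply]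
      rw [hcomm, hcomm] at hx
      have h2 := hsq μ _ hx
      rwa [← hcomm] at h2
  have hmax : ∀ μ : ℂ, A.maxGenEigenspace μ = A.eigenspace μ := by
    intro μ
    refine le_antisymm (fun x hx => ?_) ((A.genEigenspace μ).monotone le_top)
    obtain ⟨k, hk⟩ := (Module.End.mem_maxGenEigenspace _ _ _).1 hx
    rw [Module.End.mem_eigenspace_iff]
    cases k with
    | zero =>
      rw [pow_zero, Module.End.one_apply] at hk
      rw [hk, map_zero, smul_zero]
    | succ k =>
      have h := hpow μ k x hk
      rw [LinearMap.sub_apply, LinearMap.smul_apply, Module.End.one_apply, sub_eq_zero] at h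
      exact h
  rw [← Module.End.iSup_maxGenEigenspace_eq_top A]
  exact iSup_congr fun μ => (hmax μ).symm

end SelfAdjoint

/-! ### §3 Polynomials in `B B̄|_{V^{1,0}}` lie in the Levi line algebra; the trichotomy in dimension five -/

section Levi

variable {V : Type u} [AddCommGroup V] [Module ℚ V] {n : ℤ}

/-- `dim V^{1,0} = dim V^{0,1} = 5` for an effective weight-one Hodge structure of rank ten.
[cite: MoonenZarhin1999LowDim, §2 p. 715] -/
theorem SymplecticThetaTen.finrank_pieces_eq_five [Module.Finite ℚ V] (H : HodgeStructure V n) (hn : n = 1)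
    (heff : H.IsEffective) (hV : Module.finrank ℚ V = 10) {Θ : Module.End ℂ (ℂ ⊗[ℚ] V)}
    (hΘ : ∀ p, ∀ x ∈ H.piece p (n - p), Θ x = ((2 * p - n : ℤ) : ℂ) • x) :
    Module.finrank ℂ (H.piece 1 0) = 5 ∧ Module.finrank ℂ (H.piece 0 1) = 5 := by
  subst hn
  obtain ⟨hP, hQ, hΘ10, hΘ01, -⟩ := UnitaryTheta.theta_facts H rfl heff hΘ
  have hPQ : ∀ v, (2 : ℂ)⁻¹ • (v + Θ v) + (2 : ℂ)⁻¹ • (v - Θ v) = v := fun v => by module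
  have hsup : H.piece 1 0 ⊔ H.piece 0 1 = ⊤ := by
    rw [eq_top_iff]
    intro v _
    rw [← hPQ v]
    exact Submodule.add_mem_sup (hP v) (hQ v)
  have hinf : H.piece 1 0 ⊓ H.piece 0 1 = ⊥ := by
    rw [eq_bot_iff]
    intro x hx
    rw [Submodule.mem_bot]
    have h1 := hΘ10 x hx.1
    rw [hΘ01 x hx.2, neg_eq_iff_add_eq_zero, ← two_smul ℂ x, smul_eq_zero] at h1
    exact h1.resolve_left (two_ne_zero' ℂ)
  have hsum := Submodule.finrank_sup_add_finrank_inf_eq (H.piece 1 0) (H.piece 0 1)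
  rw [hsup, hinf, finrank_top, finrank_bot, add_zero, Module.finrank_baseChange, hV] at hsum
  have hsymm : Module.finrank ℂ (H.piece 1 0) = Module.finrank ℂ (H.piece 0 1) := hodgeNumber_symm_holds H 1 0
  omega

/-- **Every polynomial in `B B̄|_{V^{1,0}}` is realised by an element of `𝔤_ℂ`** (`B ∈ 𝔤_ℂ` raising, `B̄` its
conjugate, `Θ ∈ 𝔤_ℂ`): `p(BB̄) − p(B̄B) ∈ 𝔤_ℂ` (`UnitaryThetaCore.aeval_sub_aeval_mem`), `p(B̄B) = p(0)` on `V^{1,0}`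
and `Θ = 1` there. [cite: GoodmanWallachGTM255, §4.1.1] [cite: Gordon1997, §6 (proof of Thm. 6.3.3)] -/
theorem SymplecticThetaTen.aeval_mem_levi (H : HodgeStructure V n) (hn : n = 1) (heff : H.IsEffective)
    (𝔤 : Submodule ℚ (Module.End ℚ V)) (hbr : ∀ X ∈ 𝔤, ∀ X' ∈ 𝔤, X * X' - X' * X ∈ 𝔤)
    {Θ : Module.End ℂ (ℂ ⊗[ℚ] V)} (hΘ : ∀ p, ∀ x ∈ H.piece p (n - p), Θ x = ((2 * p - n : ℤ) : ℂ) • x)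
    (hΘ𝔤 : Θ ∈ spanC 𝔤) {B C : Module.End ℂ (ℂ ⊗[ℚ] V)} (hB𝔤 : B ∈ spanC 𝔤)
    (hBP : ∀ p ∈ H.piece 1 0, B p = 0) (hBim : ∀ v, B v ∈ H.piece 1 0) (hC : ∀ v, C v = conj (B (conj v)))
    (f : ℂ[X]) : ∃ Z ∈ spanC 𝔤, ∀ p ∈ H.piece 1 0, Z p = aeval (B * C) f p := by
  subst hn
  obtain ⟨-, -, hΘ10, -, -⟩ := UnitaryTheta.theta_facts H rfl heff hΘ
  have hPQ : ∀ x ∈ H.piece 1 0, conj x ∈ H.piece 0 1 := fun x hx => conj_mem_piece H hx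
  have hQP : ∀ x ∈ H.piece 0 1, conj x ∈ H.piece 1 0 := fun x hx => conj_mem_piece H hx
  obtain ⟨hCQ, hCim, -, -⟩ := SymplecticThetaTen.conjOp_raise hPQ hQP hBP hBim hC
  have h𝔊br : ∀ Z ∈ spanC 𝔤, ∀ Z' ∈ spanC 𝔤, Z * Z' - Z' * Z ∈ spanC 𝔤 := fun Z hZ Z' hZ' =>
    commutator_mem_spanC hbr hZ hZ'
  have hC𝔤 : C ∈ spanC 𝔤 := conjOp_mem_spanC hB𝔤 hC
  have hBB : B * B = 0 := LinearMap.ext fun v => by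
    rw [Module.End.mul_apply, hBP _ (hBim v), LinearMap.zero_apply]
  refine ⟨aeval (B * C) f - aeval (C * B) f + (f.coeff 0) • Θ,
    Submodule.add_mem _ (UnitaryThetaCore.aeval_sub_aeval_mem h𝔊br hB𝔤 hC𝔤 hBB f) (Submodule.smul_mem _ _ hΘ𝔤),
    fun p hp => ?_⟩
  have hCBp : (C * B) p = 0 := by rw [Module.End.mul_apply, hBP p hp, map_zero]
  rw [LinearMap.add_apply, LinearMap.sub_apply, LinearMap.smul_apply,
    UnitaryThetaCore.aeval_apply_of_apply_eq_zero (C * B) f hCBp, hΘ10 p hp, sub_add_cancel]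

/-- **The trichotomy in dimension five: the Levi line algebra is everything, or `B B̄|_{V^{1,0}}` is a scalar.**
Let `H` be an effective polarized weight-one `ℚ`-Hodge structure with `End_Hdg(V) = ℚ` and `dim V^{1,0} = 5`,
`𝔤 ⊆ End_ℚ(V)` bracket-closed and `ψ`-skew with `Θ ∈ 𝔤_ℂ`, `B ∈ 𝔤_ℂ` raising with conjugate `B̄`. Then EITHER every
endomorphism of `V^{1,0}` is the restriction of an element of `𝔤_ℂ` (the Levi line algebra `𝔩` is `End(V^{1,0})`),
OR `B B̄` acts on `V^{1,0}` as a scalar. PROOF: `B B̄|_{V^{1,0}}` is self-adjoint for `ψ_ℂ(x, conj y)` (§1), hence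
diagonalizable (§2) with spectral projectors `E_c = p_c(BB̄) ∈ 𝔩` (Hoffman–Kunze §6.7 Thm. 11; `aeval_mem_levi`);
the multiplicities sum to `5`: one of them is `1` (`E_c` is a rank-one idempotent: `𝔩 = End` by
`SymplecticThetaSix.eq_top_of_rankOne_idempotent`, `V^{1,0}` being `𝔩`-irreducible by `levi_irreducible`), or they
are `{2, 3}` (`E_a − E_b` is an involution in `𝔩` with eigenspaces of dimensions `2|3`: `𝔩 = End` by
`UnitaryThetaCore.eq_top_two_three'`), or there is a single eigenvalue (`BB̄|_{V^{1,0}} = c`).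
[cite: MoonenZarhin1999LowDim, §2 p. 715 and (2.4)–(2.7)] [cite: Ribet1983, Thm. 1]
[cite: HoffmanKunze1971LinearAlgebra, §6.7 Thm. 11] [cite: Deligne1982HodgeCycles, I §3 Prop. 3.4] -/
theorem SymplecticThetaTen.levi_eq_top_or_scalar [Module.Finite ℚ V] (H : HodgeStructure V n) (hn : n = 1)
    (heff : H.IsEffective) (ψ : H.Polarization) (hE : ∀ a ∈ H.endAlg, ∃ x : ℚ, a = x • 1)
    (𝔤 : Submodule ℚ (Module.End ℚ V)) (hbr : ∀ X ∈ 𝔤, ∀ X' ∈ 𝔤, X * X' - X' * X ∈ 𝔤)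
    {Θ : Module.End ℂ (ℂ ⊗[ℚ] V)} (hΘ : ∀ p, ∀ x ∈ H.piece p (n - p), Θ x = ((2 * p - n : ℤ) : ℂ) • x)
    (hΘ𝔤 : Θ ∈ spanC 𝔤) (hskew : ∀ X ∈ 𝔤, ∀ v w, ψ.form (X v) w + ψ.form v (X w) = 0)
    (hP5 : Module.finrank ℂ (H.piece 1 0) = 5) {B C : Module.End ℂ (ℂ ⊗[ℚ] V)} (hB𝔤 : B ∈ spanC 𝔤)
    (hBP : ∀ p ∈ H.piece 1 0, B p = 0) (hBim : ∀ v, B v ∈ H.piece 1 0) (hC : ∀ v, C v = conj (B (conj v))) :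
    (∀ A : Module.End ℂ ↥(H.piece 1 0), ∃ Z ∈ spanC 𝔤, ∀ p : ↥(H.piece 1 0),
        ((A p : ↥(H.piece 1 0)) : ℂ ⊗[ℚ] V) = Z p) ∨
      ∃ μ : ℂ, ∀ p ∈ H.piece 1 0, B (C p) = μ • p := by
  classical
  have haeval := SymplecticThetaTen.aeval_mem_levi H hn heff 𝔤 hbr hΘ hΘ𝔤 hB𝔤 hBP hBim hC
  have hirr : ∀ U : Submodule ℂ (ℂ ⊗[ℚ] V), (∀ Z ∈ spanC 𝔤, ∀ u ∈ U, Z u ∈ U) → U = ⊥ ∨ U = ⊤ :=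
    fun U hU => SymplecticTheta.eq_bot_or_top_of_stable H hn heff ψ hE 𝔤 hΘ hΘ𝔤 hskew
      fun X hX u hu => hU _ (baseChange_mem_spanC hX) u hu
  subst hn
  obtain ⟨hPmem, hQmem, hΘ10, hΘ01, hΘΘ⟩ := UnitaryTheta.theta_facts H rfl heff hΘ
  set P := H.piece 1 0 with hPdef
  set Q := H.piece 0 1 with hQdef
  set M := ℂ ⊗[ℚ] V
  set ω := ψ.form.baseChange ℂ with hω
  have h𝔊br : ∀ Z ∈ spanC 𝔤, ∀ Z' ∈ spanC 𝔤, Z * Z' - Z' * Z ∈ spanC 𝔤 := fun Z hZ Z' hZ' =>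
    commutator_mem_spanC hbr hZ hZ'
  have hBskew : ∀ x y, ω (B x) y + ω x (B y) = 0 := fun x y =>
    ThetaSubalgebra.formBaseChange_add_eq_zero_of_mem_spanC ψ hskew hB𝔤 x y
  -- the Levi line algebra `𝔩 ⊆ End(P)`
  let 𝔩 : Submodule ℂ (Module.End ℂ ↥P) :=
    { carrier := {A | ∃ Z ∈ spanC 𝔤, ∀ p : ↥P, ((A p : ↥P) : M) = Z p}
      zero_mem' := ⟨0, Submodule.zero_mem _, fun p => by simp⟩
      add_mem' := by
        rintro A A' ⟨Z, hZ, hAZ⟩ ⟨Z', hZ', hAZ'⟩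
        exact ⟨Z + Z', Submodule.add_mem _ hZ hZ', fun p => by
          rw [LinearMap.add_apply, Submodule.coe_add, hAZ, hAZ', LinearMap.add_apply]⟩
      smul_mem' := by
        rintro c A ⟨Z, hZ, hAZ⟩
        exact ⟨c • Z, Submodule.smul_mem _ _ hZ, fun p => by
          rw [LinearMap.smul_apply, Submodule.coe_smul, hAZ, LinearMap.smul_apply]⟩ }
  have hmem𝔩 : ∀ A, A ∈ 𝔩 ↔ ∃ Z ∈ spanC 𝔤, ∀ p : ↥P, ((A p : ↥P) : M) = Z p := fun A => Iff.rfl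
  have h𝔩br : ∀ A ∈ 𝔩, ∀ A' ∈ 𝔩, A * A' - A' * A ∈ 𝔩 := by
    intro A hA A' hA'
    obtain ⟨Z, hZ, hAZ⟩ := (hmem𝔩 A).1 hA
    obtain ⟨Z', hZ', hAZ'⟩ := (hmem𝔩 A').1 hA'
    refine (hmem𝔩 _).2 ⟨Z * Z' - Z' * Z, h𝔊br _ hZ _ hZ', fun p => ?_⟩
    rw [LinearMap.sub_apply, Submodule.coe_sub, Module.End.mul_apply, Module.End.mul_apply, hAZ, hAZ', hAZ',
      hAZ, LinearMap.sub_apply, Module.End.mul_apply, Module.End.mul_apply]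
  have h𝔩1 : (1 : Module.End ℂ ↥P) ∈ 𝔩 :=
    (hmem𝔩 _).2 ⟨Θ, hΘ𝔤, fun p => by rw [Module.End.one_apply, hΘ10 p p.2]⟩
  have h𝔩irr : ∀ U : Submodule ℂ ↥P, (∀ A ∈ 𝔩, ∀ u ∈ U, A u ∈ U) → U = ⊥ ∨ U = ⊤ := by
    intro U hU
    refine SymplecticThetaSix.levi_irreducible (spanC 𝔤) h𝔊br hΘ𝔤 hΘΘ hΘ10 hΘ01 hPmem hQmem hirr U
      fun Z hZ hZP u hu => ?_
    exact hU _ ((hmem𝔩 _).2 ⟨Z, hZ, fun p => rfl⟩) u hu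
  -- `A = B B̄|_P` and its polynomials
  have hBCP : ∀ x ∈ P, (B * C) x ∈ P := fun x _ => hBim _
  set A : Module.End ℂ ↥P := (B * C).restrict hBCP with hAdef
  have hAapply : ∀ p : ↥P, ((A p : ↥P) : M) = B (C p) := fun p => rfl
  have hA𝔩 : ∀ f : ℂ[X], aeval A f ∈ 𝔩 := by
    intro f
    obtain ⟨Z, hZ, hZf⟩ := haeval f
    exact (hmem𝔩 _).2 ⟨Z, hZ, fun p => by rw [UnitaryThetaCore.aeval_restrict_coe hBCP f p, hZf p p.2]⟩
  -- the definite pairing `s(x, y) = ψ_ℂ(x, conj y)` on `P`, for which `A` is self-adjoint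
  let s : ↥P → ↥P → ℂ := fun x y => ω (x : M) (conj (y : M))
  have hs : ∀ x y : ↥P, s x y = ω (x : M) (conj (y : M)) := fun x y => rfl
  have hsadd₁ : ∀ x y z : ↥P, s (x + y) z = s x z + s y z := fun x y z => by
    rw [hs, hs, hs, Submodule.coe_add, map_add, LinearMap.add_apply]
  have hssmul₁ : ∀ (c : ℂ) (x z : ↥P), s (c • x) z = c * s x z := fun c x z => by
    rw [hs, hs, Submodule.coe_smul, map_smul, LinearMap.smul_apply, smul_eq_mul]
  have hsadd₂ : ∀ x y z : ↥P, s x (y + z) = s x y + s x z := fun x y z => by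
    rw [hs, hs, hs, Submodule.coe_add, map_add, map_add]
  have hssmul₂ : ∀ (c : ℂ) (x y : ↥P), s x (c • y) = starRingEnd ℂ c * s x y := fun c x y => by
    rw [hs, hs, Submodule.coe_smul, conj_smul, map_smul, smul_eq_mul]
  have hsdef : ∀ x : ↥P, s x x = 0 → x = 0 := by
    intro x hx
    by_contra hx0
    have hx0' : (x : M) ≠ 0 := fun h => hx0 (Subtype.ext h)
    exact ψ.form_conj_ne_zero (p := 1) (q := 0) (by norm_num) x.2 hx0' hx
  have hAsa : ∀ x y : ↥P, s (A x) y = s x (A y) := fun x y => by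
    rw [hs, hs, hAapply, hAapply]
    exact (SymplecticThetaTen.form_mul_conjOp_conj ψ.form hC hBskew (x : M) (y : M)).1
  obtain ⟨-, -, htop⟩ := SymplecticThetaTen.iSup_eigenspace_eq_top_of_selfAdjoint s hsadd₁ hssmul₁ hsadd₂ hssmul₂
    hsdef A hAsa
  -- the spectral resolution of `A`
  have hdiag := (Literature.LinearAlgebra.exists_basis_toMatrix_eq_diagonal_iff_iSup_eigenspace_eq_top A).2 htop
  obtain ⟨E, hElag, hAsum, hEsum, hEorth, hEidem, hErange, hEne⟩ :=
    Literature.LinearAlgebra.exists_resolution_of_diagonalizable A hdiag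
  set S := A.finite_hasEigenvalue.toFinset with hSdef
  have hE𝔩 : ∀ c, E c ∈ 𝔩 := fun c => by rw [hElag c]; exact hA𝔩 _
  have hEapply_mem : ∀ c ∈ S, ∀ x : ↥P, E c x ∈ A.eigenspace c := fun c hc x => by
    rw [← hErange c hc]; exact LinearMap.mem_range_self _ _
  -- dimension count `Σ_{c ∈ S} dim Eig_c = 5`
  set d : ℂ → ℕ := fun c => Module.finrank ℂ ↥(A.eigenspace c) with hddef
  have hbiSup : ⨆ c ∈ S, A.eigenspace c = ⊤ := by
    rw [eq_top_iff]
    intro x _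
    rw [Literature.LinearAlgebra.eq_sum_resolution_apply hEsum x]
    refine Submodule.sum_mem _ fun c hc => ?_
    exact Submodule.mem_iSup_of_mem c (Submodule.mem_iSup_of_mem hc (hEapply_mem c hc x))
  have hdsum : ∑ c ∈ S, d c = 5 := by
    have h := Literature.LinearAlgebra.finrank_biSup_eigenspace_eq_sum A S
    rw [hbiSup, finrank_top, hP5] at h
    exact h.symm
  have hdpos : ∀ c ∈ S, 1 ≤ d c := by
    intro c hc
    rw [Nat.one_le_iff_ne_zero]
    intro h0
    have hbot : A.eigenspace c = ⊥ := Submodule.finrank_eq_zero.1 h0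
    apply hEne c hc
    refine LinearMap.ext fun x => ?_
    have hx := hEapply_mem c hc x
    rw [hbot, Submodule.mem_bot] at hx
    rw [hx, LinearMap.zero_apply]
  -- CASE 1: a simple eigenvalue gives a rank-one idempotent in `𝔩`
  by_cases h1 : ∃ c ∈ S, d c = 1
  · left
    obtain ⟨c, hc, hdc⟩ := h1
    obtain ⟨u, hu, hu0⟩ : ∃ u ∈ A.eigenspace c, u ≠ 0 := by
      have hne : A.eigenspace c ≠ ⊥ := fun h => by
        have : d c = 0 := by
          show Module.finrank ℂ ↥(A.eigenspace c) = 0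
          rw [h, finrank_bot]
        omega
      exact (Submodule.ne_bot_iff _).1 hne
    have hdc' : Module.finrank ℂ ↥(A.eigenspace c) = 1 := hdc
    have hline : ∀ w ∈ A.eigenspace c, ∃ r : ℂ, r • u = w := by
      intro w hw
      have hu0' : (⟨u, hu⟩ : ↥(A.eigenspace c)) ≠ 0 := fun h => hu0 (congrArg Subtype.val h)
      obtain ⟨r, hr⟩ := (finrank_eq_one_iff_of_nonzero' (⟨u, hu⟩ : ↥(A.eigenspace c)) hu0').1 hdc' ⟨w, hw⟩
      exact ⟨r, congrArg Subtype.val hr⟩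
    have hπu : E c u = u := by
      obtain ⟨y, hy⟩ : u ∈ LinearMap.range (E c) := by rw [hErange c hc]; exact hu
      rw [← hy, ← Module.End.mul_apply, hEidem c hc]
    obtain ⟨ℓ, hℓ⟩ := Module.Projective.exists_dual_eq_one ℂ hu0
    set φ : Module.Dual ℂ ↥P := ℓ ∘ₗ E c with hφdef
    have hφu : φ u = 1 := by rw [hφdef, LinearMap.comp_apply, hπu, hℓ]
    have hπeq : φ.smulRight u = E c := by
      refine LinearMap.ext fun x => ?_
      obtain ⟨r, hr⟩ := hline _ (hEapply_mem c hc x)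
      rw [LinearMap.smulRight_apply, hφdef, LinearMap.comp_apply, ← hr, map_smul, hℓ, smul_eq_mul, mul_one]
    have he : φ.smulRight u ∈ 𝔩 := by rw [hπeq]; exact hE𝔩 c
    have htop𝔩 := SymplecticThetaSix.eq_top_of_rankOne_idempotent 𝔩 h𝔩br h𝔩1 h𝔩irr hφu he
    intro A'
    exact (hmem𝔩 A').1 (htop𝔩 ▸ Submodule.mem_top)
  · push Not at h1
    have hd2 : ∀ c ∈ S, 2 ≤ d c := fun c hc => by
      have h := hdpos c hc; have h' := h1 c hc; omega
    have hcard : S.card ≤ 2 := by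
      have h := Finset.card_nsmul_le_sum S d 2 hd2
      rw [hdsum, smul_eq_mul] at h
      omega
    have hcard0 : S.card ≠ 0 := by
      intro h0
      rw [Finset.card_eq_zero] at h0
      rw [h0, Finset.sum_empty] at hdsum
      omega
    rcases Nat.lt_or_ge S.card 2 with hlt | hge
    · -- CASE 3: a single eigenvalue, `A = c`
      right
      have hcard1 : S.card = 1 := by omega
      obtain ⟨c, hSc⟩ := Finset.card_eq_one.1 hcard1
      refine ⟨c, fun p hp => ?_⟩
      have hA1 : A = c • 1 := by
        rw [hSc, Finset.sum_singleton] at hAsum hEsum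
        rw [hAsum, hEsum]
      have h := congrArg (fun T : Module.End ℂ ↥P => ((T ⟨p, hp⟩ : ↥P) : M)) hA1
      simpa only [hAapply, LinearMap.smul_apply, Module.End.one_apply, Submodule.coe_smul] using h
    · -- CASE 2: two eigenvalues of multiplicities `{2, 3}`
      left
      have hcard2 : S.card = 2 := le_antisymm hcard hge
      obtain ⟨a, b, hab, hSab⟩ := Finset.card_eq_two.1 hcard2
      have hsumab : d a + d b = 5 := by rw [hSab, Finset.sum_pair hab] at hdsum; exact hdsum
      have ha : a ∈ S := by rw [hSab]; exact Finset.mem_insert_self _ _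
      have hb : b ∈ S := by rw [hSab]; exact Finset.mem_insert_of_mem (Finset.mem_singleton_self _)
      have hda2 := hd2 a ha
      have hdb2 := hd2 b hb
      -- the involution `E_x − E_y` for an ordered pair with multiplicities `(2, 3)`
      have key : ∀ x y : ℂ, x ∈ S → y ∈ S → x ≠ y → E x + E y = 1 → d x = 2 → d y = 3 → 𝔩 = ⊤ := by
        intro x y hx hy hxy hsum2 hdx hdy
        set Θ' : Module.End ℂ ↥P := E x - E y with hΘ'def
        have hΘ'𝔩 : Θ' ∈ 𝔩 := by
          obtain ⟨Zx, hZx, hZxE⟩ := (hmem𝔩 _).1 (hE𝔩 x)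
          obtain ⟨Zy, hZy, hZyE⟩ := (hmem𝔩 _).1 (hE𝔩 y)
          exact (hmem𝔩 _).2 ⟨Zx - Zy, Submodule.sub_mem _ hZx hZy, fun p => by
            rw [hΘ'def, LinearMap.sub_apply, Submodule.coe_sub, hZxE, hZyE, LinearMap.sub_apply]⟩
        have hxx := hEidem x hx
        have hyy := hEidem y hy
        have hxy0 := hEorth x hx y hy hxy
        have hyx0 := hEorth y hy x hx (Ne.symm hxy)
        have hdecomp : ∀ v : ↥P, E x v + E y v = v := fun v => by
          rw [← LinearMap.add_apply, hsum2, Module.End.one_apply]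
        have hΘ'apply : ∀ v : ↥P, Θ' v = E x v - E y v := fun v => rfl
        have hΘ'sq : Θ' * Θ' = 1 := by
          refine LinearMap.ext fun v => ?_
          have h1 : E x (E x v) = E x v := by rw [← Module.End.mul_apply, hxx]
          have h2 : E x (E y v) = 0 := by rw [← Module.End.mul_apply, hxy0, LinearMap.zero_apply]
          have h3 : E y (E x v) = 0 := by rw [← Module.End.mul_apply, hyx0, LinearMap.zero_apply]
          have h4 : E y (E y v) = E y v := by rw [← Module.End.mul_apply, hyy]
          rw [Module.End.mul_apply, hΘ'apply, hΘ'apply, map_sub, map_sub, h1, h2, h3, h4, Module.End.one_apply,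
            sub_zero, zero_sub, sub_neg_eq_add, hdecomp]
        have hPx : ∀ v, v ∈ A.eigenspace x ↔ Θ' v = v := by
          intro v
          constructor
          · intro hv
            obtain ⟨w, hw⟩ : v ∈ LinearMap.range (E x) := by rw [hErange x hx]; exact hv
            rw [hΘ'apply, ← hw, ← Module.End.mul_apply, ← Module.End.mul_apply, hxx, hyx0, LinearMap.zero_apply,
              sub_zero]
          · intro hv
            rw [hΘ'apply] at hv
            have h2 : (2 : ℂ) • E y v = 0 := by
              rw [two_smul]
              calc E y v + E y v = (E x v + E y v) - (E x v - E y v) := by abel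
                _ = 0 := by rw [hdecomp, hv, sub_self]
            have hy0 : E y v = 0 := (smul_eq_zero.1 h2).resolve_left two_ne_zero
            have hv' : E x v = v := by rw [hy0, sub_zero] at hv; exact hv
            rw [← hv', ← hErange x hx]
            exact LinearMap.mem_range_self _ _
        have hQy : ∀ v, v ∈ A.eigenspace y ↔ Θ' v = -v := by
          intro v
          constructor
          · intro hv
            obtain ⟨w, hw⟩ : v ∈ LinearMap.range (E y) := by rw [hErange y hy]; exact hv
            rw [hΘ'apply, ← hw, ← Module.End.mul_apply, ← Module.End.mul_apply, hyy, hxy0, LinearMap.zero_apply,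
              zero_sub]
          · intro hv
            rw [hΘ'apply] at hv
            have h2 : (2 : ℂ) • E x v = 0 := by
              rw [two_smul]
              calc E x v + E x v = (E x v + E y v) + (E x v - E y v) := by abel
                _ = 0 := by rw [hdecomp, hv, add_neg_cancel]
            have hx0 : E x v = 0 := (smul_eq_zero.1 h2).resolve_left two_ne_zero
            have hv' : v = E y v := by
              have h := hdecomp v
              rw [hx0, zero_add] at h
              exact h.symm
            rw [hv', ← hErange y hy]
            exact LinearMap.mem_range_self _ _
        exact UnitaryThetaCore.eq_top_two_three' h𝔩br h𝔩irr hΘ'𝔩 hΘ'sq hPx hQy hdx hdy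
      have hsumE : E a + E b = 1 := by rw [hSab, Finset.sum_pair hab] at hEsum; exact hEsum
      have htop𝔩 : 𝔩 = ⊤ := by
        rcases (show (d a = 2 ∧ d b = 3) ∨ (d a = 3 ∧ d b = 2) by omega) with ⟨h2, h3⟩ | ⟨h3, h2⟩
        · exact key a b ha hb hab hsumE h2 h3
        · exact key b a hb ha (Ne.symm hab) (by rw [add_comm]; exact hsumE) h2 h3
      intro A'
      exact (hmem𝔩 A').1 (htop𝔩 ▸ Submodule.mem_top)

end Levi

/-! ### §4 From the Levi line algebra to `𝔰𝔭(V,ψ)_ℂ`; the plus line; the dichotomy in rank ten -/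

section Main

variable {V : Type u} [AddCommGroup V] [Module ℚ V] {n : ℤ}

/-- **If the Levi line algebra is `End(V^{1,0})`, then `𝔤_ℂ = 𝔰𝔭(V,ψ)_ℂ`** (any rank): a rank-one idempotent
`p ↦ ψ_ℂ(p, ξ) a` of `V^{1,0}` (`ξ ∈ V^{0,1}` by Lagrangian duality, `SymplecticThetaSix.exists_repr_dual`) is then
realised in `𝔤_ℂ`, and `SymplecticThetaSix.core_of_rankOne` gives `𝔲⁺ ⊕ 𝔤𝔩(V^{1,0}) ⊕ 𝔲⁻ ⊆ 𝔤_ℂ`; every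
`ψ_ℂ`-skew `Y` is `Y₋ + Y₀ + Y₊` along `ad Θ`. [cite: MoonenZarhin1999LowDim, §2 p. 715 and (2.3)]
[cite: GoodmanWallachGTM255, §2.1.2] [cite: Gordon1997, §6 (proof of Thm. 6.3.3)] -/
theorem SymplecticThetaTen.mem_spanC_of_skew_of_levi [Module.Finite ℚ V] (H : HodgeStructure V n) (hn : n = 1)
    (heff : H.IsEffective) (ψ : H.Polarization) (hE : ∀ a ∈ H.endAlg, ∃ x : ℚ, a = x • 1)
    (𝔤 : Submodule ℚ (Module.End ℚ V)) (hbr : ∀ X ∈ 𝔤, ∀ X' ∈ 𝔤, X * X' - X' * X ∈ 𝔤)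
    {Θ : Module.End ℂ (ℂ ⊗[ℚ] V)} (hΘ : ∀ p, ∀ x ∈ H.piece p (n - p), Θ x = ((2 * p - n : ℤ) : ℂ) • x)
    (hΘ𝔤 : Θ ∈ spanC 𝔤) (hskew : ∀ X ∈ 𝔤, ∀ v w, ψ.form (X v) w + ψ.form v (X w) = 0)
    (hP0 : H.piece 1 0 ≠ ⊥)
    (hlevi : ∀ A : Module.End ℂ ↥(H.piece 1 0), ∃ Z ∈ spanC 𝔤, ∀ p : ↥(H.piece 1 0),
        ((A p : ↥(H.piece 1 0)) : ℂ ⊗[ℚ] V) = Z p)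
    {Y : Module.End ℂ (ℂ ⊗[ℚ] V)}
    (hYskew : ∀ x y, ψ.form.baseChange ℂ (Y x) y + ψ.form.baseChange ℂ x (Y y) = 0) : Y ∈ spanC 𝔤 := by
  classical
  have hirr : ∀ U : Submodule ℂ (ℂ ⊗[ℚ] V), (∀ Z ∈ spanC 𝔤, ∀ u ∈ U, Z u ∈ U) → U = ⊥ ∨ U = ⊤ :=
    fun U hU => SymplecticTheta.eq_bot_or_top_of_stable H hn heff ψ hE 𝔤 hΘ hΘ𝔤 hskew
      fun X hX u hu => hU _ (baseChange_mem_spanC hX) u hu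
  subst hn
  obtain ⟨hPmem, hQmem, hΘ10, hΘ01, hΘΘ⟩ := UnitaryTheta.theta_facts H rfl heff hΘ
  set P := H.piece 1 0 with hPdef
  set Q := H.piece 0 1 with hQdef
  set M := ℂ ⊗[ℚ] V
  set ω := ψ.form.baseChange ℂ with hω
  have hωnd : ω.Nondegenerate := ψ.nondegenerate_baseChange
  have hωalt : ∀ x y, ω x y = -ω y x := fun x y => by
    rw [hω, ψ.form_baseChange_swap y x, Int.negOnePow_odd 1 odd_one]
    norm_num
  have h𝔊br : ∀ Z ∈ spanC 𝔤, ∀ Z' ∈ spanC 𝔤, Z * Z' - Z' * Z ∈ spanC 𝔤 := fun Z hZ Z' hZ' =>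
    commutator_mem_spanC hbr hZ hZ'
  have h𝔊skew : ∀ Z ∈ spanC 𝔤, ∀ x y, ω (Z x) y + ω x (Z y) = 0 := fun Z hZ =>
    ThetaSubalgebra.formBaseChange_add_eq_zero_of_mem_spanC ψ hskew hZ
  -- Lagrangian duality between `P` and `Q`
  have hPQv : ∀ v, (2 : ℂ)⁻¹ • (v + Θ v) + (2 : ℂ)⁻¹ • (v - Θ v) = v := fun v => by module
  have hTskew := h𝔊skew Θ hΘ𝔤
  have hPiso : ∀ x ∈ P, ∀ y ∈ P, ω x y = 0 := fun x hx y hy => by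
    have h := hTskew x y
    rw [hΘ10 x hx, hΘ10 y hy] at h
    exact add_self_eq_zero.1 h
  have hQiso : ∀ x ∈ Q, ∀ y ∈ Q, ω x y = 0 := fun x hx y hy => by
    have h := hTskew x y
    rw [hΘ01 x hx, hΘ01 y hy, map_neg, LinearMap.neg_apply, map_neg, ← neg_add, neg_eq_zero, add_self_eq_zero] at h
    exact h
  have hdetP : ∀ x ∈ P, (∀ q ∈ Q, ω x q = 0) → x = 0 := fun x hx h =>
    hωnd.1 x fun y => by
      rw [← hPQv y, map_add, hPiso x hx _ (hPmem y), h _ (hQmem y), add_zero]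
  have hdetQ : ∀ y ∈ Q, (∀ p ∈ P, ω p y = 0) → y = 0 := fun y hy h =>
    hωnd.2 y fun x => by
      rw [← hPQv x, map_add, LinearMap.add_apply, h _ (hPmem x), hQiso _ (hQmem x) y hy, add_zero]
  -- a rank-one idempotent of `P`, realised in `𝔤_ℂ`
  obtain ⟨a, ha, ha0⟩ := (Submodule.ne_bot_iff P).1 hP0
  have ha0' : (⟨a, ha⟩ : ↥P) ≠ 0 := fun h => ha0 (congrArg Subtype.val h)
  obtain ⟨φ, hφa⟩ := Module.Projective.exists_dual_eq_one ℂ ha0'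
  obtain ⟨ξ, hξ, hξφ⟩ := SymplecticThetaSix.exists_repr_dual ω hdetP hdetQ φ
  have haξ : ω a ξ = 1 := by rw [hξφ ⟨a, ha⟩, hφa]
  obtain ⟨Ze, hZe, hZeφ⟩ := hlevi (φ.smulRight ⟨a, ha⟩)
  have hZea : ∀ p ∈ P, Ze p = ω p ξ • a := fun p hp => by
    rw [← hZeφ ⟨p, hp⟩, LinearMap.smulRight_apply, Submodule.coe_smul, ← hξφ ⟨p, hp⟩]
  have hZeP : ∀ p ∈ P, Ze p ∈ P := fun p hp => by rw [hZea p hp]; exact Submodule.smul_mem _ _ ha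
  obtain ⟨hA, hB, hC⟩ := SymplecticThetaSix.core_of_rankOne ω hωnd hωalt (spanC 𝔤) h𝔊br h𝔊skew hΘ𝔤 hΘΘ
    hΘ10 hΘ01 hPmem hQmem hirr hZe hZeP ha hξ haξ hZea
  -- decompose `Y` along `ad Θ` inside the `ψ_ℂ`-skew operators
  let 𝔰 : Submodule ℂ (Module.End ℂ (ℂ ⊗[ℚ] V)) :=
    { carrier := {Z | ∀ x y, ω (Z x) y + ω x (Z y) = 0}
      zero_mem' := fun x y => by simp
      add_mem' := by
        intro Z Z' hZ hZ' x y
        simp only [LinearMap.add_apply, map_add]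
        have h1 := hZ x y
        have h2 := hZ' x y
        linear_combination h1 + h2
      smul_mem' := by
        intro c Z hZ x y
        simp only [LinearMap.smul_apply, map_smul, smul_eq_mul]
        have h1 := hZ x y
        linear_combination c * h1 }
  have hmem𝔰 : ∀ Z, Z ∈ 𝔰 ↔ ∀ x y, ω (Z x) y + ω x (Z y) = 0 := fun Z => Iff.rfl
  have h𝔰br : ∀ Z ∈ 𝔰, ∀ Z' ∈ 𝔰, Z * Z' - Z' * Z ∈ 𝔰 := by
    intro Z hZ Z' hZ'
    rw [hmem𝔰] at hZ hZ' ⊢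
    intro x y
    simp only [LinearMap.sub_apply, Module.End.mul_apply, map_sub]
    have h1 := hZ (Z' x) y
    have h2 := hZ x (Z' y)
    have h3 := hZ' (Z x) y
    have h4 := hZ' x (Z y)
    linear_combination h1 - h4 + h2 - h3
  have hΘ𝔰 : Θ ∈ 𝔰 := (hmem𝔰 Θ).2 hTskew
  have hY𝔰 : Y ∈ 𝔰 := (hmem𝔰 Y).2 hYskew
  obtain ⟨Ym, hYm, Y0, hY0, Yp, hYp, hYeq, hYpP, hYpim, hYmQ, hYmim, -, -, hY0P, hY0Q⟩ :=
    SymplecticTheta.exists_decomp 𝔰 h𝔰br hΘ𝔰 hΘΘ (P := P) (Q := Q) hΘ10 hΘ01 hPmem hQmem hY𝔰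
  rw [hYeq]
  refine Submodule.add_mem _ (Submodule.add_mem _ ?_ ?_) ?_
  · exact hC Ym ((hmem𝔰 Ym).1 hYm) hYmQ hYmim
  · exact hB Y0 ((hmem𝔰 Y0).1 hY0) hY0P hY0Q
  · exact hA Yp ((hmem𝔰 Yp).1 hYp) hYpP hYpim

/-- **The plus line.** (Any rank.) If EVERY raising `B ∈ 𝔤_ℂ` has `B B̄` acting on `V^{1,0}` as a scalar, then the
raising operators of `𝔤_ℂ` form a LINE `ℂB₀`, the lowering operators the conjugate line `ℂB̄₀`, and
`B₀B̄₀ = μ₀` on `V^{1,0}`, `B̄₀B₀ = μ₀` on `V^{0,1}` with `μ₀` real and non-zero — the plus-line (type-III-like,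
Mumford-type) position `𝔤_ℂ = ℂB₀ ⊕ 𝔤_ℂ⁰ ⊕ ℂB̄₀` of the tree's `HodgeLieWeightOnePlusLine*`. PROOF: a non-zero
raising `B₀ ∈ 𝔤_ℂ` exists (else `V^{0,1}` is `𝔤_ℂ`-stable); `μ₀ ≠ 0` and `μ₀ ∈ ℝ` by the second Hodge–Riemann
relation (`ψ_ℂ(B₀B̄₀p, conj p) = −ψ_ℂ(B̄₀p, conj B̄₀p)`); for a raising `B` the scalars of
`(B₀ + tB)(B̄₀ + t̄B̄)` at `t = 1, i` give `B₀B̄ = γ` on `V^{1,0}`, whence `B̄ = (γ/μ₀)B̄₀` (`B₀` is injective on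
`V^{0,1}`) and `B = conj(γ/μ₀) B₀`. [cite: MoonenZarhin1999LowDim, §2 (2.3)–(2.5)]
[cite: Mumford1969NoteShimura, §4] [cite: Deligne1982HodgeCycles, I §3 Prop. 3.4 and Prop. 3.6] -/
theorem SymplecticThetaTen.plusLine_of_forall_scalar [Module.Finite ℚ V] (H : HodgeStructure V n) (hn : n = 1)
    (heff : H.IsEffective) (ψ : H.Polarization) (hE : ∀ a ∈ H.endAlg, ∃ x : ℚ, a = x • 1)
    (𝔤 : Submodule ℚ (Module.End ℚ V)) (hbr : ∀ X ∈ 𝔤, ∀ X' ∈ 𝔤, X * X' - X' * X ∈ 𝔤)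
    {Θ : Module.End ℂ (ℂ ⊗[ℚ] V)} (hΘ : ∀ p, ∀ x ∈ H.piece p (n - p), Θ x = ((2 * p - n : ℤ) : ℂ) • x)
    (hΘ𝔤 : Θ ∈ spanC 𝔤) (hskew : ∀ X ∈ 𝔤, ∀ v w, ψ.form (X v) w + ψ.form v (X w) = 0)
    (hP0 : H.piece 1 0 ≠ ⊥)
    (hscalar : ∀ B ∈ spanC 𝔤, (∀ p ∈ H.piece 1 0, B p = 0) → (∀ v, B v ∈ H.piece 1 0) →
      ∀ C : Module.End ℂ (ℂ ⊗[ℚ] V), (∀ v, C v = conj (B (conj v))) →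
        ∃ μ : ℂ, ∀ p ∈ H.piece 1 0, B (C p) = μ • p) :
    ∃ B₀ ∈ spanC 𝔤, ∃ C₀ ∈ spanC 𝔤, ∃ μ₀ : ℂ,
      B₀ ≠ 0 ∧ (∀ p ∈ H.piece 1 0, B₀ p = 0) ∧ (∀ v, B₀ v ∈ H.piece 1 0) ∧
      (∀ v, C₀ v = conj (B₀ (conj v))) ∧ (∀ q ∈ H.piece 0 1, C₀ q = 0) ∧ (∀ v, C₀ v ∈ H.piece 0 1) ∧
      μ₀ ≠ 0 ∧ starRingEnd ℂ μ₀ = μ₀ ∧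
      (∀ p ∈ H.piece 1 0, B₀ (C₀ p) = μ₀ • p) ∧ (∀ q ∈ H.piece 0 1, C₀ (B₀ q) = μ₀ • q) ∧
      (∀ B ∈ spanC 𝔤, (∀ p ∈ H.piece 1 0, B p = 0) → (∀ v, B v ∈ H.piece 1 0) → ∃ c : ℂ, B = c • B₀) ∧
      (∀ C ∈ spanC 𝔤, (∀ q ∈ H.piece 0 1, C q = 0) → (∀ v, C v ∈ H.piece 0 1) → ∃ c : ℂ, C = c • C₀) := by
  classical
  have hirr : ∀ U : Submodule ℂ (ℂ ⊗[ℚ] V), (∀ Z ∈ spanC 𝔤, ∀ u ∈ U, Z u ∈ U) → U = ⊥ ∨ U = ⊤ :=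
    fun U hU => SymplecticTheta.eq_bot_or_top_of_stable H hn heff ψ hE 𝔤 hΘ hΘ𝔤 hskew
      fun X hX u hu => hU _ (baseChange_mem_spanC hX) u hu
  subst hn
  obtain ⟨hPmem, hQmem, hΘ10, hΘ01, hΘΘ⟩ := UnitaryTheta.theta_facts H rfl heff hΘ
  set P := H.piece 1 0 with hPdef
  set Q := H.piece 0 1 with hQdef
  set M := ℂ ⊗[ℚ] V
  set ω := ψ.form.baseChange ℂ with hω
  have hPQ : ∀ x ∈ P, conj x ∈ Q := fun x hx => conj_mem_piece H hx
  have hQP : ∀ x ∈ Q, conj x ∈ P := fun x hx => conj_mem_piece H hx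
  have h𝔊br : ∀ Z ∈ spanC 𝔤, ∀ Z' ∈ spanC 𝔤, Z * Z' - Z' * Z ∈ spanC 𝔤 := fun Z hZ Z' hZ' =>
    commutator_mem_spanC hbr hZ hZ'
  have h𝔊skew : ∀ Z ∈ spanC 𝔤, ∀ x y, ω (Z x) y + ω x (Z y) = 0 := fun Z hZ =>
    ThetaSubalgebra.formBaseChange_add_eq_zero_of_mem_spanC ψ hskew hZ
  have hPQv : ∀ v, (2 : ℂ)⁻¹ • (v + Θ v) + (2 : ℂ)⁻¹ • (v - Θ v) = v := fun v => by module
  have hPQ0 : ∀ x ∈ P, x ∈ Q → x = 0 := fun x hxP hxQ => by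
    have h1 := hΘ10 x hxP
    rw [hΘ01 x hxQ, neg_eq_iff_add_eq_zero, ← two_smul ℂ x, smul_eq_zero] at h1
    exact h1.resolve_left (two_ne_zero' ℂ)
  have hext : ∀ Y Y' : Module.End ℂ M, (∀ p ∈ P, Y p = Y' p) → (∀ q ∈ Q, Y q = Y' q) → Y = Y' :=
    fun Y Y' h1 h2 => LinearMap.ext fun v => by
      rw [← hPQv v, map_add, map_add, h1 _ (hPmem v), h2 _ (hQmem v)]
  have hdec := fun Z (hZ : Z ∈ spanC 𝔤) =>
    SymplecticTheta.exists_decomp (spanC 𝔤) h𝔊br hΘ𝔤 hΘΘ hΘ10 hΘ01 hPmem hQmem hZ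
  -- `P ≠ 0 ≠ Q`
  obtain ⟨a, ha, ha0⟩ := (Submodule.ne_bot_iff P).1 hP0
  have hQne : Q ≠ ⊥ := fun h => by
    have h1 : conj a ∈ Q := hPQ a ha
    rw [h, Submodule.mem_bot] at h1
    exact ha0 (by rw [← conj_conj a, h1, map_zero])
  -- a non-zero raising operator `B₀ ∈ 𝔤_ℂ`
  obtain ⟨B₀, hB₀𝔊, hB₀P, hB₀im, hB₀0⟩ :
      ∃ B ∈ spanC 𝔤, (∀ p ∈ P, B p = 0) ∧ (∀ v, B v ∈ P) ∧ B ≠ 0 := by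
    by_contra hcon
    push Not at hcon
    have hQstab : ∀ Z ∈ spanC 𝔤, ∀ q ∈ Q, Z q ∈ Q := by
      intro Z hZ q hq
      obtain ⟨Zm', hZm', Z0', hZ0', Zp', hZp', hZeq', hZpP', hZpim', hZmQ', -, -, -, -, hZ0Q'⟩ := hdec Z hZ
      rw [hZeq', LinearMap.add_apply, LinearMap.add_apply, hZmQ' q hq, zero_add, hcon Zp' hZp' hZpP' hZpim',
        LinearMap.zero_apply, add_zero]
      exact hZ0Q' q hq
    rcases hirr Q hQstab with h | h
    · exact hQne h
    · exact hP0 (by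
        rw [eq_bot_iff]
        intro x hx
        rw [Submodule.mem_bot]
        exact hPQ0 x hx (h ▸ Submodule.mem_top))
  -- its conjugate `C₀ = B̄₀`
  obtain ⟨C₀, hC₀⟩ := exists_conjOp B₀
  have hC₀𝔊 : C₀ ∈ spanC 𝔤 := conjOp_mem_spanC hB₀𝔊 hC₀
  obtain ⟨hC₀Q, hC₀im, hcC₀, hcB₀⟩ := SymplecticThetaTen.conjOp_raise hPQ hQP hB₀P hB₀im hC₀
  have hB₀skew := h𝔊skew B₀ hB₀𝔊
  obtain ⟨μ₀, hμ₀⟩ := hscalar B₀ hB₀𝔊 hB₀P hB₀im C₀ hC₀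
  -- `μ₀ ≠ 0`
  have hμ₀0 : μ₀ ≠ 0 := by
    intro h0
    have hC₀P : ∀ p ∈ P, C₀ p = 0 := by
      intro p hp
      by_contra hne
      have h1 := (SymplecticThetaTen.form_mul_conjOp_conj ψ.form hC₀ hB₀skew p p).2
      rw [hμ₀ p hp, h0, zero_smul, map_zero, LinearMap.zero_apply, eq_comm, neg_eq_zero] at h1
      exact ψ.form_conj_ne_zero (p := 0) (q := 1) (by norm_num) (hC₀im p) hne h1
    have hC₀0 : C₀ = 0 := hext C₀ 0 (fun p hp => by rw [hC₀P p hp, LinearMap.zero_apply])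
      fun q hq => by rw [hC₀Q q hq, LinearMap.zero_apply]
    apply hB₀0
    refine LinearMap.ext fun v => ?_
    rw [← conj_conj v, ← hcC₀, hC₀0, LinearMap.zero_apply, map_zero, LinearMap.zero_apply]
  -- `μ₀` is real
  have hμ₀r : starRingEnd ℂ μ₀ = μ₀ := by
    have hs0 : ω a (conj a) ≠ 0 := ψ.form_conj_ne_zero (p := 1) (q := 0) (by norm_num) ha ha0
    have h1 := (SymplecticThetaTen.form_mul_conjOp_conj ψ.form hC₀ hB₀skew a a).1
    rw [hμ₀ a ha, map_smul, LinearMap.smul_apply, conj_smul, map_smul, smul_eq_mul, smul_eq_mul] at h1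
    exact (mul_right_cancel₀ hs0 h1).symm
  -- `C₀ B₀ = μ₀` on `Q`
  have hC₀B₀ : ∀ q ∈ Q, C₀ (B₀ q) = μ₀ • q := by
    intro q hq
    have h1 : conj (C₀ (B₀ q)) = μ₀ • conj q := by rw [hcC₀, hcB₀, hμ₀ _ (hQP q hq)]
    rw [← conj_conj (C₀ (B₀ q)), h1, conj_smul, hμ₀r, conj_conj]
  -- `B₀` is injective on `Q`
  have hB₀inj : ∀ w ∈ Q, B₀ w = 0 → w = 0 := fun w hw h0 => by
    have h := hC₀B₀ w hw
    rw [h0, map_zero] at h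
    exact ((smul_eq_zero.1 h.symm).resolve_left hμ₀0)
  -- the raising operators form the line `ℂ B₀`
  have hline : ∀ B ∈ spanC 𝔤, (∀ p ∈ P, B p = 0) → (∀ v, B v ∈ P) → ∃ c : ℂ, B = c • B₀ := by
    intro B hB𝔊 hBP hBim
    obtain ⟨C, hC⟩ := exists_conjOp B
    obtain ⟨hCQ, hCim, hcC, hcB⟩ := SymplecticThetaTen.conjOp_raise hPQ hQP hBP hBim hC
    obtain ⟨μB, hμB⟩ := hscalar B hB𝔊 hBP hBim C hC
    -- the scalar of `(B₀ + tB)(C₀ + conj t · C)` on `P`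
    have hpol : ∀ t : ℂ, ∃ ν : ℂ, ∀ p ∈ P,
        starRingEnd ℂ t • B₀ (C p) + t • B (C₀ p) = ν • p := by
      intro t
      have hBt : B₀ + t • B ∈ spanC 𝔤 := Submodule.add_mem _ hB₀𝔊 (Submodule.smul_mem _ _ hB𝔊)
      have hBtP : ∀ p ∈ P, (B₀ + t • B) p = 0 := fun p hp => by
        rw [LinearMap.add_apply, LinearMap.smul_apply, hB₀P p hp, hBP p hp, smul_zero, add_zero]
      have hBtim : ∀ v, (B₀ + t • B) v ∈ P := fun v => by
        rw [LinearMap.add_apply, LinearMap.smul_apply]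
        exact Submodule.add_mem _ (hB₀im v) (Submodule.smul_mem _ _ (hBim v))
      have hCt : ∀ v, (C₀ + starRingEnd ℂ t • C) v = conj ((B₀ + t • B) (conj v)) := fun v => by
        rw [LinearMap.add_apply, LinearMap.smul_apply, LinearMap.add_apply, LinearMap.smul_apply, map_add,
          conj_smul, hC₀, hC]
      obtain ⟨μt, hμt⟩ := hscalar _ hBt hBtP hBtim _ hCt
      refine ⟨μt - μ₀ - t * starRingEnd ℂ t * μB, fun p hp => ?_⟩
      have h := hμt p hp
      rw [show (C₀ + starRingEnd ℂ t • C) p = C₀ p + starRingEnd ℂ t • C p from rfl, LinearMap.add_apply,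
        LinearMap.smul_apply, map_add, map_smul, map_add, map_smul, hμ₀ p hp, hμB p hp] at h
      rw [sub_smul, sub_smul, ← h, mul_assoc, mul_smul, mul_smul]
      module
    obtain ⟨ν₁, hν₁⟩ := hpol 1
    obtain ⟨ν₂, hν₂⟩ := hpol Complex.I
    set γ : ℂ := (2 : ℂ)⁻¹ * (ν₁ + Complex.I * ν₂) with hγ
    have hB₀C : ∀ p ∈ P, B₀ (C p) = γ • p := by
      intro p hp
      have h1 := hν₁ p hp
      have h2 := hν₂ p hp
      rw [map_one, one_smul, one_smul] at h1
      rw [Complex.conj_I] at h2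
      have h3 : (2 : ℂ) • B₀ (C p) = (B₀ (C p) + B (C₀ p)) + Complex.I • (-Complex.I • B₀ (C p) +
          Complex.I • B (C₀ p)) := by
        rw [smul_add, smul_smul, smul_smul, Complex.I_mul_I, mul_neg, Complex.I_mul_I, neg_neg, one_smul,
          neg_one_smul, two_smul]
        abel
      rw [h1, h2, smul_smul, ← add_smul] at h3
      rw [hγ, mul_smul, ← h3, smul_smul, inv_mul_cancel₀ (two_ne_zero' ℂ), one_smul]
    -- `C = (γ/μ₀) C₀`
    have hCeq : C = (γ / μ₀) • C₀ := by
      refine hext _ _ (fun p hp => ?_) fun q hq => by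
        rw [hCQ q hq, LinearMap.smul_apply, hC₀Q q hq, smul_zero]
      rw [LinearMap.smul_apply, ← sub_eq_zero]
      refine hB₀inj _ (Submodule.sub_mem _ (hCim p) (Submodule.smul_mem _ _ (hC₀im p))) ?_
      rw [map_sub, map_smul, hB₀C p hp, hμ₀ p hp, smul_smul, div_mul_cancel₀ γ hμ₀0, sub_self]
    refine ⟨starRingEnd ℂ (γ / μ₀), LinearMap.ext fun v => ?_⟩
    have h1 : B v = conj (C (conj v)) := by rw [hcC, conj_conj]
    rw [h1, hCeq, LinearMap.smul_apply, conj_smul, hcC₀, conj_conj, LinearMap.smul_apply]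
  refine ⟨B₀, hB₀𝔊, C₀, hC₀𝔊, μ₀, hB₀0, hB₀P, hB₀im, hC₀, hC₀Q, hC₀im, hμ₀0, hμ₀r, hμ₀, hC₀B₀, hline, ?_⟩
  -- the lowering operators form the conjugate line `ℂ C₀`
  intro C' hC'𝔊 hC'Q hC'im
  obtain ⟨B', hB'⟩ := exists_conjOp C'
  have hB'𝔊 : B' ∈ spanC 𝔤 := conjOp_mem_spanC hC'𝔊 hB'
  obtain ⟨hB'P, hB'im, hcB', hcC'⟩ := SymplecticThetaTen.conjOp_raise (P := Q) (Q := P) hQP hPQ hC'Q hC'im hB'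
  obtain ⟨c, hc⟩ := hline B' hB'𝔊 hB'P hB'im
  refine ⟨starRingEnd ℂ c, LinearMap.ext fun v => ?_⟩
  have h1 : C' v = conj (B' (conj v)) := by rw [hcB', conj_conj]
  rw [h1, hc, LinearMap.smul_apply, conj_smul, ← hC₀, LinearMap.smul_apply]

/-- **THE DICHOTOMY IN RANK TEN.** Let `H` be an effective polarized weight-one `ℚ`-Hodge structure with
`dim V = 10` and `End_Hdg(V) = ℚ`, and `𝔤 ⊆ End_ℚ(V)` a bracket-closed `ℚ`-subspace of `ψ`-skew operators whose
complex span contains a Hodge operator `Θ`. Then EITHER every `ψ_ℂ`-skew operator of `V_ℂ` lies in `𝔤_ℂ`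
(`𝔤_ℂ = 𝔰𝔭(V,ψ)_ℂ ≅ 𝔰𝔭₁₀` — Moonen–Zarhin: «for `g = 5` we always find that `Hg(X) = Sp_D(V,φ)`»), OR `𝔤_ℂ`
is in the plus-line position of `plusLine_of_forall_scalar` (raising line `ℂB₀`, lowering line `ℂB̄₀`,
`B₀B̄₀ = μ₀ ≠ 0` on `V^{1,0}`, `B̄₀B₀ = μ₀` on `V^{0,1}` — the complexified shape `𝔰𝔩₂ ⊗ 1 ⊕ 1 ⊗ 𝔨` on
`ℂ² ⊗ ℂ⁵` of Mumford's examples, whose exclusion under `End_Hdg(V) = ℚ` is arithmetic).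
[cite: MoonenZarhin1999LowDim, §2 p. 715 and (2.4)–(2.7)] [cite: Ribet1983, Thm. 1]
[cite: Mumford1969NoteShimura, §4] [cite: Deligne1982HodgeCycles, I §3 Prop. 3.4] -/
theorem SymplecticThetaTen.dichotomy [Module.Finite ℚ V] (H : HodgeStructure V n) (hn : n = 1)
    (heff : H.IsEffective) (ψ : H.Polarization) (hE : ∀ a ∈ H.endAlg, ∃ x : ℚ, a = x • 1)
    (hV : Module.finrank ℚ V = 10) (𝔤 : Submodule ℚ (Module.End ℚ V))
    (hbr : ∀ X ∈ 𝔤, ∀ X' ∈ 𝔤, X * X' - X' * X ∈ 𝔤) {Θ : Module.End ℂ (ℂ ⊗[ℚ] V)}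
    (hΘ : ∀ p, ∀ x ∈ H.piece p (n - p), Θ x = ((2 * p - n : ℤ) : ℂ) • x) (hΘ𝔤 : Θ ∈ spanC 𝔤)
    (hskew : ∀ X ∈ 𝔤, ∀ v w, ψ.form (X v) w + ψ.form v (X w) = 0) :
    (∀ Y : Module.End ℂ (ℂ ⊗[ℚ] V),
        (∀ x y, ψ.form.baseChange ℂ (Y x) y + ψ.form.baseChange ℂ x (Y y) = 0) → Y ∈ spanC 𝔤) ∨
      ∃ B₀ ∈ spanC 𝔤, ∃ C₀ ∈ spanC 𝔤, ∃ μ₀ : ℂ,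
        B₀ ≠ 0 ∧ (∀ p ∈ H.piece 1 0, B₀ p = 0) ∧ (∀ v, B₀ v ∈ H.piece 1 0) ∧
        (∀ v, C₀ v = conj (B₀ (conj v))) ∧ (∀ q ∈ H.piece 0 1, C₀ q = 0) ∧ (∀ v, C₀ v ∈ H.piece 0 1) ∧
        μ₀ ≠ 0 ∧ starRingEnd ℂ μ₀ = μ₀ ∧
        (∀ p ∈ H.piece 1 0, B₀ (C₀ p) = μ₀ • p) ∧ (∀ q ∈ H.piece 0 1, C₀ (B₀ q) = μ₀ • q) ∧
        (∀ B ∈ spanC 𝔤, (∀ p ∈ H.piece 1 0, B p = 0) → (∀ v, B v ∈ H.piece 1 0) → ∃ c : ℂ, B = c • B₀) ∧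
        (∀ C ∈ spanC 𝔤, (∀ q ∈ H.piece 0 1, C q = 0) → (∀ v, C v ∈ H.piece 0 1) → ∃ c : ℂ, C = c • C₀) := by
  have hP5 := (SymplecticThetaTen.finrank_pieces_eq_five H hn heff hV hΘ).1
  have hP0 : H.piece 1 0 ≠ ⊥ := fun h => by rw [h, finrank_bot] at hP5; exact absurd hP5 (by norm_num)
  by_cases hsc : ∀ B ∈ spanC 𝔤, (∀ p ∈ H.piece 1 0, B p = 0) → (∀ v, B v ∈ H.piece 1 0) →
      ∀ C : Module.End ℂ (ℂ ⊗[ℚ] V), (∀ v, C v = conj (B (conj v))) →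
        ∃ μ : ℂ, ∀ p ∈ H.piece 1 0, B (C p) = μ • p
  · exact Or.inr (SymplecticThetaTen.plusLine_of_forall_scalar H hn heff ψ hE 𝔤 hbr hΘ hΘ𝔤 hskew hP0 hsc)
  · left
    push Not at hsc
    obtain ⟨B, hB𝔤, hBP, hBim, C, hC, hnot⟩ := hsc
    rcases SymplecticThetaTen.levi_eq_top_or_scalar H hn heff ψ hE 𝔤 hbr hΘ hΘ𝔤 hskew hP5 hB𝔤 hBP hBim hC with
      hlevi | ⟨μ, hμ⟩
    · intro Y hY
      exact SymplecticThetaTen.mem_spanC_of_skew_of_levi H hn heff ψ hE 𝔤 hbr hΘ hΘ𝔤 hskew hP0 hlevi hY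
    · obtain ⟨p, hp, hne⟩ := hnot μ
      exact absurd (hμ p hp) hne

end Main

end HodgeStructure

end Literature.AlgebraicGeometry.Motives

end
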